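/- Copyright: the b2b-balaban cell (near-miss cell 7), T⁴-continuum fan-out; row NE7b OWNER lineage `t4-ne7b-p1`
(gen 98 v1.2; gen 99 v1.4 = ruling W-ne7bp1-g99-1 + amendment A1 — §6b `integral_dens_eq_of_lt` is leaf-06 g134's located
opt-2, folded with credit; the normalisation slot after leaf-02 g107's located item L-leaf02-g107-1
— §5's `etermN`∕`reprOf` are leaf-02's `reprOfB` sketch 2863890996ddc5f5 §1, folded with credit —, §9 re-typed PER REGION
after the refuter's located point π-IR97-2 (PRICING-NE7b v50)) — owner elaboration for INTERFACE REQUEST NE7b IR-97-2 ((A2)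
module 1 of the (α)-instance), part 2 of 3; part 1's tower shape after, and both parts typed ∕ filed by, the gaps seat
pub-balaban-gaps-ne6 g2 (typist under W-ne7bp1-g98-1 ∕ -2, X-read chair leaf-04).  Released under the licence of the
surrounding project. -/
import Summits.QuantumFields.BalabanUV.T4Continuum.Support.B16HistoryReprChain

/-!
# (α)-INSTANCE, milestone (A2) module 1, part 2 of 3: M1 ∕ M2-A (`HIndex`, `Repr172R`, `termSet`, `weight`) INHABITED BY
THE HISTORY TERMS OF A TOWER, WITH «(1.72) holds» PROVED and the normalisation in the `A′` slot — re-open object (α) of row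
NE7b (`SCOPE-alpha.md` v2.27 §5; memo `g61/NC-NE7b-alpha-OPTIONS.md` §2 (A2)); INTERFACE REQUEST NE7b IR-97-2 of the row OWNER
`t4-ne7b-p1` (name reserved by W-ne7bp1-g97-1, journal l.46254; part 1 = `B16HistoryReprChain`; part 3 = `B16HistoryReprTie179`,
the (1.79) tie per region, split off by W-ne7bp1-g99-1 for the 400-line lint)

Summits-side support leaf of the T⁴-continuum cell (rung (B)+1 on a FINITE torus only; NOT infinite volume, NOT the mass
gap, NOT Clay; NOT a proof of NE7b — the cell's OWN estimate, NOT PRINTED, NOT PROVED).  [folklore] finite-sum algebra over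
part 1 (`Tower`: `adm`, `eterm`, `opsAlong`, `dens`, `wAlong`, `abs_eterm_le`, `integral_dens_eq`), M1 (`B16RelPosOp`:
`mulR`, `idR`; `B16HistoryIndexedRepr`: `HIndex`, `Repr172R`, `term`, `eterm`) and M2-A (`B16HistoryIndexedFamily`: `termSet`,
`weight`, `integral_eq_sum_weight`); nothing printed is asserted, no `def … : Prop` fact of Bałaban's, no cite-tagged
hypothesis, zero `sorry`.  [Balaban1989LargeFieldII] (1.71)∕(1.72) pp. 378–379 are quoted as LOCATORS only.  (Section
numbers continue the (A2) module's: §1, §2, §6 in part 1; §6b, §5, §7, §8 here; §9 in part 3.)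

WHAT.  The END's record `HistReadDataLWL` displays `holdsA : ∀ K t V, ρA K t V = Σ_a (RA K t).term a V` for SOME skeleton
`I K` and SOME operations `RA K t`.  Here the term family is THE TOWER's (part 1): §5 the skeleton **`skel`** at cutoff `K`
over `Dom := Unit` — outer summands `Bool`: the all-small history `hsmall` ALONE (`false`; M1 forces `𝐓″ = id` there, so
its history term sits in the curly slot; admissibility = the displayed clause `p₀ j ∈ branch j g`) and «some large field
occurred» (`true`) carrying EVERY OTHER admissible history in its `HZs` coordinate (so the live small factors sit in `wZ`,
where M2-B's `forest_le` reads them); the operations **`reprOf`** (`χ ≡ 1`, `V ≡ 0`; **`A′ ≡ log B`** for a bound `B > 0`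
of the dressed initial density — the record's `BA` slot, NOT the volume letters (leaf-02 g107, L-leaf02-g107-1); the
history operation of `h ≠ hsmall` = MULTIPLICATION BY ITS NORMALISED HISTORY TERM `B⁻¹·eterm h` (`etermN`; M1's `mulR`) —
M1's operations are same-level, the tower's maps cross levels, so the level-`K` datum a history leaves is its value); and
**`holds`**: `dens K V = Σ_a (reprOf …).term a V` PROVED (`e^{A′} = B` cancels `B⁻¹`); M1's `eterm` = the tower's history
term (`eterm_true`∕`eterm_false`); the envelope slots computed B-FREE (`TZh_true_one_le`: unit weight `≤ wAlong w K h` —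
M2-B's `tz_le` slot; `TC_false_one_le`).  §7 the cutoff ∕ source family (one tower per cutoff `K` on its own lattices
`C K j`, one dressed initial density `ρ₀ K t` and bound `B K t` per source value): **`skelFam`** = the END's `I`,
**`reprFam`** = `RA`, **`densFam`** = `ρA`, **`holdsFam`** = `holdsA` AS A THEOREM; M2-A's weights computed
(`weight_true`∕`weight_false`), their total = the level-0 integral of `ρ₀ K t` under termwise integral preservation
(`sum_weight_eq`, displays at the levels `j < K` only, via §6b's `Tower.integral_dens_eq_of_lt` — leaf-06 g134 opt-2; with H2's
dressing this is `H2A`'s left side).  §8 a decided toy (non-vacuity).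

NOT HERE (honest).  Which tower is Bałaban's ((A1c)); the regions `Dom`, the localisation `adm X` and the reading
`HistReading` of new regions off a history; the identification `HistRead.forest_le` ((A3): the step factors against the
level factors of the process's components — [B16] p. 384 l. 4–6 —, (A3)∕M4's first cost item; leaf-02's J1 sketch inhabits
`HistRead` for this instance GIVEN that display); M5's banking; any estimate.  BY-NAME EFFECT ON THE WALL (`WALL-NE7b-P1.md`
§2): NONE — `holdsA`∕`intA` become inspections for a tower-form run, `hR` is untouched.  HONEST DEPENDENCY (cell): continuum
YM on T⁴ ⇐ BetaPertH ∧ nine spine estimates (0/9 proved); BetaPertH ⇐ (D1) ∧ (D4) ∧ CAP+tail; G-an2-4 gates asym, D1 and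
NE2/3/4.  This file changes none of it.
-/

open Finset MeasureTheory
open Literature.MathematicalPhysics.QuantumFieldTheory.Balaban1983to89

/-! ## §6b (part 1 addendum, leaf-06 g134 opt-2) The total integral telescopes from the levels BELOW the cutoff only -/

namespace Summit.QuantumFields.BalabanUV.T4Continuum.B16HistoryReprChain.Tower

open Summit.QuantumFields.BalabanUV.T4Continuum.B16HistoryIndexedRepr

variable {P : Type} {C : ℕ → Type} {𝒢 : (j : ℕ) → GoodClass (C j)} (T : Tower P C 𝒢)

/-- **`integral_dens_eq` WITH ITS THREE DISPLAYS ASKED ONLY AT THE LEVELS `j < K`** (leaf-06 g134's located opt-2, folded by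
W-ne7bp1-g99-1 A1): a cutoff-`K` run never visits the levels `j ≥ K`, where part 1's `∀ j` form of `hpres` is unsatisfiable
for the natural padding `branch K g = ∅` (`∫ 0 ≠ ∫ eterm K g`); same induction. [folklore] -/
theorem integral_dens_eq_of_lt [∀ j, MeasurableSpace (C j)] (μ : (j : ℕ) → Measure (C j)) (ρ₀ : C 0 → ℝ) :
    ∀ K, (∀ j g, j < K → g ∈ T.adm j → Integrable (T.eterm ρ₀ j g) (μ j)) →
      (∀ j g p, j < K → g ∈ T.adm j → p ∈ T.branch j g → Integrable ((T.op j g p).T (T.eterm ρ₀ j g)) (μ (j + 1))) →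
      (∀ j g, j < K → g ∈ T.adm j →
        ∫ x, (∑ p ∈ T.branch j g, (T.op j g p).T (T.eterm ρ₀ j g) x) ∂μ (j + 1) = ∫ x, T.eterm ρ₀ j g x ∂μ j) →
      ∫ V, T.dens ρ₀ K V ∂μ K = ∫ U, ρ₀ U ∂μ 0
  | 0, _, _, _ => by simp [dens_zero]
  | K + 1, hint, hint', hpres => by
      have e : (fun V => T.dens ρ₀ (K + 1) V) =
          fun V => ∑ g ∈ T.adm K, ∑ p ∈ T.branch K g, (T.op K g p).T (T.eterm ρ₀ K g) V :=
        funext (T.dens_succ ρ₀ K)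
      rw [e, integral_finsetSum _ (fun g hg => integrable_finsetSum _ fun p hp => hint' K g p K.lt_succ_self hg hp)]
      rw [Finset.sum_congr rfl fun g hg => hpres K g K.lt_succ_self hg]
      rw [← integral_finsetSum _ fun g hg => hint K g K.lt_succ_self hg]
      exact integral_dens_eq_of_lt μ ρ₀ K (fun j g hj => hint j g (Nat.lt_succ_of_lt hj))
        (fun j g p hj => hint' j g p (Nat.lt_succ_of_lt hj)) (fun j g hj => hpres j g (Nat.lt_succ_of_lt hj))

end Summit.QuantumFields.BalabanUV.T4Continuum.B16HistoryReprChain.Tower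

namespace Summit.QuantumFields.BalabanUV.T4Continuum.B16HistoryReprInstance

open Summit.QuantumFields.BalabanUV.T4Continuum.B16HistoryIndexedRepr
open Summit.QuantumFields.BalabanUV.T4Continuum.B16HistoryReprChain

/-! ## §5 THE INSTANCE: M1's skeleton and operations at the cutoff `K`, inhabited by the tower's history terms -/

section Instance

variable {P : Type} {C : ℕ → Type} {𝒢 : (j : ℕ) → GoodClass (C j)} (T : Tower P C 𝒢) (p₀ : ℕ → P) (K : ℕ)

/-- **THE ALL-SMALL HISTORY**: the small-field choice `p₀ j` at every step. [folklore] -/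
def hsmall (p₀ : ℕ → P) (K : ℕ) : Fin K → P := fun j => p₀ j

/-- The all-small history is admissible when the small-field choice is admissible after every history (displayed:
`p₀ j ∈ branch j g`). [folklore] -/
theorem hsmall_mem (hp₀ : ∀ j g, p₀ j ∈ T.branch j g) : ∀ K, hsmall p₀ K ∈ T.adm K
  | 0 => by
      show hsmall p₀ 0 ∈ (Finset.univ : Finset (Fin 0 → P))
      exact Finset.mem_univ _
  | K + 1 => (T.mem_adm_succ _).2 ⟨hsmall_mem hp₀ K, hp₀ K _⟩

/-- `T.adm K` is NONEMPTY. [folklore] -/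
theorem adm_nonempty (hp₀ : ∀ j g, p₀ j ∈ T.branch j g) : (T.adm K).Nonempty :=
  ⟨hsmall p₀ K, hsmall_mem T p₀ hp₀ K⟩

/-- **THE NORMALISED HISTORY TERM** `B⁻¹ · eterm K h` (leaf-02 g107's `etermN`). [folklore] -/
noncomputable def etermN (ρ₀ : C 0 → ℝ) (B : ℝ) (h : Fin K → P) : C K → ℝ := fun V => B⁻¹ * T.eterm ρ₀ K h V

/-- The normalised history term is good. [folklore] -/
theorem etermN_good {ρ₀ : C 0 → ℝ} (hρ : (𝒢 0).Gd ρ₀) (B : ℝ) (h : Fin K → P) : (𝒢 K).Gd (etermN T K ρ₀ B h) :=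
  (𝒢 K).smul B⁻¹ (T.eterm_good hρ K h)

/-- The normalised history term is non-negative. [folklore] -/
theorem etermN_nonneg {ρ₀ : C 0 → ℝ} (hρ : (𝒢 0).Gd ρ₀) (h0 : ∀ x, 0 ≤ ρ₀ x) {B : ℝ} (hB : 0 < B)
    (h : Fin K → P) (V : C K) : 0 ≤ etermN T K ρ₀ B h V :=
  mul_nonneg (inv_nonneg.mpr hB.le) (T.eterm_nonneg hρ h0 K h V)

/-- **U1 FOR THE NORMALISED TERM, B-FREE**: `|ρ₀| ≤ B`, per-step envelopes `w` ⟹ `B⁻¹ · eterm K h ≤ wAlong w K h`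
(part 1's `abs_eterm_le` divided by `B > 0`). [folklore] -/
theorem etermN_le_wAlong {ρ₀ : C 0 → ℝ} (hρ : (𝒢 0).Gd ρ₀) {B : ℝ} (hB : 0 < B)
    (w : (j : ℕ) → (Fin j → P) → P → ℝ) (hw0 : ∀ j g p, 0 ≤ w j g p)
    (hw : ∀ j g p x, (T.op j g p).T (fun _ => 1) x ≤ w j g p) (hBρ : ∀ y, |ρ₀ y| ≤ B) (h : Fin K → P) (V : C K) :
    etermN T K ρ₀ B h V ≤ Tower.wAlong w K h :=
  (inv_mul_le_iff₀ hB).mpr ((le_abs_self _).trans (T.abs_eterm_le w hw0 hw hρ hB.le hBρ K h V))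

variable [DecidableEq P]

/-- **THE INDEX SKELETON OF THE TOWER AT CUTOFF `K`** (M1's `HIndex` over `Dom := Unit`): two outer summands — `false` =
the all-small summand (its one history `hsmall`; M1 forces `𝐓″ = id` there) and `true` = «some large field occurred», whose
`HZs` coordinate carries EVERY OTHER admissible history; one sub-history choice and one curly summand each. [folklore] -/
@[reducible] def skel : HIndex Unit where
  Adm := Bool
  Zc a := if a then {()} else ∅
  Ys _ := ∅
  index_inj a b h _ := by
    cases a <;> cases b <;> simp_all
  HZ := Fin K → P
  HL := Unit
  HC := Unit
  HZs a := if a then (T.adm K).erase (hsmall p₀ K) else {hsmall p₀ K}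
  HYs _ := {()}
  HCs _ := {()}
  allSmall := false
  Zc_allSmall := rfl
  Ys_allSmall := rfl
  hz₀ := hsmall p₀ K
  HZs_allSmall := rfl
  hl₀ := ()
  HYs_allSmall := rfl

variable {ρ₀ : C 0 → ℝ} (hρ : (𝒢 0).Gd ρ₀) (h0 : ∀ x, 0 ≤ ρ₀ x) {B : ℝ} (hB : 0 < B)

/-- **THE OPERATIONS OF THE TOWER OVER `skel`** (M1's `Repr172R` relative to the level-`K` class), NORMALISED: `χ ≡ 1`,
`A′ ≡ log B`, `V ≡ 0`; the history operation of `h ≠ hsmall` multiplies by `B⁻¹ · eterm h` (good, non-negative — M1's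
`mulR`); the all-small summand carries `B⁻¹ · eterm hsmall` in its curly slot (leaf-02 g107's `reprOfB`). [folklore] -/
noncomputable def reprOf : Repr172R (𝒢 K) (skel T p₀ K) where
  χ _ _ := 1
  A' _ := Real.log B
  TZh a h := if a then RelLinPosOp.mulR (etermN T K ρ₀ B h) (etermN_good T K hρ B h) (etermN_nonneg T K hρ h0 hB h)
    else RelLinPosOp.idR (𝒢 K)
  TYl _ _ := RelLinPosOp.idR (𝒢 K)
  TC a _ := if a then RelLinPosOp.idR (𝒢 K)
    else RelLinPosOp.mulR (etermN T K ρ₀ B (hsmall p₀ K)) (etermN_good T K hρ B _) (etermN_nonneg T K hρ h0 hB _)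
  Vs _ _ _ _ _ := 0
  χ_good _ := (𝒢 K).const 1
  expA_good := (𝒢 K).const (Real.exp (Real.log B))
  E_good _ _ _ _ := (𝒢 K).const (Real.exp 0)
  TZh_allSmall _ := rfl
  TYl_allSmall _ := rfl

/-- THE COMPLETED-ACTION SLOT CARRIES THE NORMALISATION: `A′ ≡ log B` (M2-B's `A'_le` reads `BA K t := log (B K t)`;
the record's `hBA ≤ BAi`). [folklore] -/
theorem A'_apply (W : C K) : (reprOf T p₀ K hρ h0 hB).A' W = Real.log B := rfl

/-- The large summand's term: the sum of the history terms of all admissible histories but the all-small one (the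
normalisation `B⁻¹` cancels against `e^{A′} = B`). [folklore] -/
theorem term_true (V : C K) :
    (reprOf T p₀ K hρ h0 hB).term true V = ∑ h ∈ (T.adm K).erase (hsmall p₀ K), T.eterm ρ₀ K h V := by
  show (1 : ℝ) * ∑ h ∈ (T.adm K).erase (hsmall p₀ K), B⁻¹ * T.eterm ρ₀ K h V *
      (Real.exp (Real.log B) * ∑ l ∈ ({()} : Finset Unit), ∑ c ∈ ({()} : Finset Unit), Real.exp 0) = _
  rw [Real.exp_log hB, one_mul]
  refine Finset.sum_congr rfl fun h _ => ?_
  simp only [Finset.sum_singleton, Real.exp_zero, mul_one]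
  field_simp

/-- The all-small summand's term: the all-small history term. [folklore] -/
theorem term_false (V : C K) :
    (reprOf T p₀ K hρ h0 hB).term false V = T.eterm ρ₀ K (hsmall p₀ K) V := by
  show (1 : ℝ) * ∑ h ∈ ({hsmall p₀ K} : Finset (Fin K → P)),
      (Real.exp (Real.log B) * ∑ l ∈ ({()} : Finset Unit), ∑ c ∈ ({()} : Finset Unit),
        B⁻¹ * T.eterm ρ₀ K (hsmall p₀ K) V * Real.exp 0) = _
  rw [Real.exp_log hB, one_mul]
  simp only [Finset.sum_singleton, Real.exp_zero, mul_one]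
  field_simp

/-- **«(1.72) HOLDS» PROVED FOR THE TOWER**: the level-`K` density in term form is the sum of the terms of `reprOf` over
the skeleton's outer summands — the END's `holdsA` display, as a theorem, for this term family. [folklore] -/
theorem holds (hp₀ : ∀ j g, p₀ j ∈ T.branch j g) (V : C K) :
    T.dens ρ₀ K V = ∑ a : (skel T p₀ K).Adm, (reprOf T p₀ K hρ h0 hB).term a V := by
  show ∑ h ∈ T.adm K, T.eterm ρ₀ K h V = ∑ a : Bool, (reprOf T p₀ K hρ h0 hB).term a V
  rw [Fintype.sum_bool, term_true, term_false, Finset.sum_erase_add _ _ (hsmall_mem T p₀ hp₀ K)]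

/-- The elementary term (M1) of a large-summand history IS its history term (tower). [folklore] -/
theorem eterm_true (h : Fin K → P) (V : C K) :
    (reprOf T p₀ K hρ h0 hB).eterm true (h, (), ()) V = T.eterm ρ₀ K h V := by
  show (1 : ℝ) * (B⁻¹ * T.eterm ρ₀ K h V * (Real.exp (Real.log B) * Real.exp 0)) = _
  rw [Real.exp_log hB, Real.exp_zero]
  field_simp

/-- The elementary term (M1) of the all-small summand IS the all-small history term. [folklore] -/
theorem eterm_false (V : C K) :
    (reprOf T p₀ K hρ h0 hB).eterm false (hsmall p₀ K, (), ()) V = T.eterm ρ₀ K (hsmall p₀ K) V := by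
  show (1 : ℝ) * (Real.exp (Real.log B) * (B⁻¹ * T.eterm ρ₀ K (hsmall p₀ K) V * Real.exp 0)) = _
  rw [Real.exp_log hB, Real.exp_zero]
  field_simp

/-- THE ENVELOPE SLOTS, COMPUTED: the history operation's unit weight IS the normalised history term. [folklore] -/
theorem TZh_true_one (h : Fin K → P) (W : C K) :
    ((reprOf T p₀ K hρ h0 hB).TZh true h).T (fun _ => 1) W = etermN T K ρ₀ B h W := by
  show etermN T K ρ₀ B h W * 1 = _
  rw [mul_one]

/-- … the all-small curly composite's unit weight IS the normalised all-small history term. [folklore] -/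
theorem TC_false_one (W : C K) :
    ((reprOf T p₀ K hρ h0 hB).TC false ()).T (fun _ => 1) W = etermN T K ρ₀ B (hsmall p₀ K) W := by
  show etermN T K ρ₀ B (hsmall p₀ K) W * 1 = _
  rw [mul_one]

/-- **M2-B's `tz_le` SLOT SERVED B-FREE BY THE PRODUCT OF PER-STEP FACTORS ALONG THE HISTORY**: `|ρ₀| ≤ B` and
per-step envelopes `w` ⟹ the history operation's unit weight is at most `wAlong w K h`. [folklore] -/
theorem TZh_true_one_le (w : (j : ℕ) → (Fin j → P) → P → ℝ) (hw0 : ∀ j g p, 0 ≤ w j g p)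
    (hw : ∀ j g p x, (T.op j g p).T (fun _ => 1) x ≤ w j g p) (hBρ : ∀ y, |ρ₀ y| ≤ B) (h : Fin K → P) (W : C K) :
    ((reprOf T p₀ K hρ h0 hB).TZh true h).T (fun _ => 1) W ≤ Tower.wAlong w K h := by
  rw [TZh_true_one]
  exact etermN_le_wAlong T K hρ hB w hw0 hw hBρ h W

/-- **M2-B's `tc_le` SLOT OF THE ALL-SMALL SUMMAND, B-FREE**. [folklore] -/
theorem TC_false_one_le (w : (j : ℕ) → (Fin j → P) → P → ℝ) (hw0 : ∀ j g p, 0 ≤ w j g p)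
    (hw : ∀ j g p x, (T.op j g p).T (fun _ => 1) x ≤ w j g p) (hBρ : ∀ y, |ρ₀ y| ≤ B) (W : C K) :
    ((reprOf T p₀ K hρ h0 hB).TC false ()).T (fun _ => 1) W ≤ Tower.wAlong w K (hsmall p₀ K) := by
  rw [TC_false_one]
  exact etermN_le_wAlong T K hρ hB w hw0 hw hBρ _ W

end Instance

/-! ## §7 THE CUTOFF ∕ SOURCE FAMILY: one tower per cutoff `K` (its own lattices), one dressed initial density and one
normalisation per source value `t` — the END's `I K`, `RA K t`, `ρA K t`, `holdsA` BY NAME, and M2-A's weights computed -/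

section Family

variable {P : Type} [DecidableEq P] {C : ℕ → ℕ → Type} {𝒢 : (K j : ℕ) → GoodClass (C K j)}
  (T : (K : ℕ) → Tower P (C K) (𝒢 K)) (p₀ : ℕ → ℕ → P)
  (ρ₀ : (K : ℕ) → ℝ → C K 0 → ℝ) (hρ : ∀ K t, (𝒢 K 0).Gd (ρ₀ K t)) (h0 : ∀ K t x, 0 ≤ ρ₀ K t x)
  (B : ℕ → ℝ → ℝ) (hB : ∀ K t, 0 < B K t)

/-- **THE CUTOFF FAMILY OF SKELETONS** `I K` (the run with cutoff `K` has `K` steps and its own tower `T K`, small-field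
choices `p₀ K j`). [folklore] -/
@[reducible] def skelFam (K : ℕ) : HIndex Unit := skel (T K) (p₀ K) K

/-- The END's record binds `[DecidableEq (HIndex.Idx I)]`; `HIndex.Idx` is a plain `def`, so the instance for `skelFam` is
supplied by unfolding it to its Σ-type (located finding F1 of leaf-06 g133 ∕ chair leaf-04 g126, folded). [folklore] -/
instance instDecidableEqIdxSkelFam : DecidableEq (HIndex.Idx (skelFam T p₀)) :=
  inferInstanceAs (DecidableEq (Σ K : ℕ, Σ _ : Bool, (Fin K → P) × Unit × Unit))

/-- **THE CUTOFF ∕ SOURCE FAMILY OF OPERATIONS** `RA K t` over `I K`, relative to the class of the run's LAST level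
`C K K` (the END's `X K`), from the dressed initial density `ρ₀ K t` with bound `B K t`. [folklore] -/
noncomputable def reprFam (K : ℕ) (t : ℝ) : Repr172R (𝒢 K K) (skelFam T p₀ K) :=
  reprOf (T K) (p₀ K) K (hρ K t) (h0 K t) (hB K t)

/-- **THE DRESSED FINAL DENSITIES** `ρA K t`: level `K` of the cutoff-`K` tower started at `ρ₀ K t`. [folklore] -/
def densFam (K : ℕ) (t : ℝ) : C K K → ℝ := (T K).dens (ρ₀ K t) K

/-- **THE END's `holdsA` FOR THE FAMILY, AS A THEOREM**: `∀ K t V, ρA K t V = Σ_a (RA K t).term a V` with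
`ρA := densFam`, `RA := reprFam`, `I := skelFam` (`holds` per cutoff). [folklore] -/
theorem holdsFam (hp₀ : ∀ K j g, p₀ K j ∈ (T K).branch j g) (K : ℕ) (t : ℝ) (V : C K K) :
    densFam T ρ₀ K t V = ∑ a : (skelFam T p₀ K).Adm, (reprFam T p₀ ρ₀ hρ h0 B hB K t).term a V :=
  holds (T K) (p₀ K) K (hρ K t) (h0 K t) (hB K t) (hp₀ K) V

section Weights

variable [∀ K, MeasurableSpace (C K K)] (μ : (K : ℕ) → Measure (C K K))

/-- **M2-A's WEIGHT OF A LARGE-SUMMAND TERM IS THE INTEGRAL OF ITS HISTORY TERM**. [folklore] -/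
theorem weight_true (K : ℕ) (t : ℝ) (h : Fin K → P) :
    Repr172R.weight (I := skelFam T p₀) μ (reprFam T p₀ ρ₀ hρ h0 B hB) t ⟨K, true, (h, (), ())⟩ =
      ∫ x, (T K).eterm (ρ₀ K t) K h x ∂μ K := by
  show ∫ x, (reprFam T p₀ ρ₀ hρ h0 B hB K t).eterm true (h, (), ()) x ∂μ K = _
  exact congrArg (fun f : C K K → ℝ => ∫ x, f x ∂μ K)
    (funext fun x => eterm_true (T K) (p₀ K) K (hρ K t) (h0 K t) (hB K t) h x)

/-- … and the all-small term's weight is the integral of the all-small history term. [folklore] -/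
theorem weight_false (K : ℕ) (t : ℝ) :
    Repr172R.weight (I := skelFam T p₀) μ (reprFam T p₀ ρ₀ hρ h0 B hB) t ⟨K, false, (hsmall (p₀ K) K, (), ())⟩ =
      ∫ x, (T K).eterm (ρ₀ K t) K (hsmall (p₀ K) K) x ∂μ K := by
  show ∫ x, (reprFam T p₀ ρ₀ hρ h0 B hB K t).eterm false (hsmall (p₀ K) K, (), ()) x ∂μ K = _
  exact congrArg (fun f : C K K → ℝ => ∫ x, f x ∂μ K)
    (funext fun x => eterm_false (T K) (p₀ K) K (hρ K t) (h0 K t) (hB K t) x)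

end Weights

/-- **THE TOTAL OF THE WEIGHTS IS THE LEVEL-0 INTEGRAL OF THE DRESSED INITIAL DENSITY** when, after every admissible
history of a level BELOW THE CUTOFF, the one-step operation preserves that term's integral (displayed termwise, `j < K` —
leaf-06 g134 opt-2) and the terms are integrable (displayed; part 1 §6 discharges it in the model class) — M2-A's
`integral_eq_sum_weight` ∘ `holdsFam` ∘ `integral_dens_eq_of_lt`; with H2's dressing `ρ₀ K t = e^{t·obs}·ρ₀` this is the
END's `H2A` left side computed. [folklore] -/
theorem sum_weight_eq [∀ K j, MeasurableSpace (C K j)] (ν : (K j : ℕ) → Measure (C K j))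
    (hp₀ : ∀ K j g, p₀ K j ∈ (T K).branch j g)
    (hint : ∀ K t j g, j < K → g ∈ (T K).adm j → Integrable ((T K).eterm (ρ₀ K t) j g) (ν K j))
    (hint' : ∀ K t j g p, j < K → g ∈ (T K).adm j → p ∈ (T K).branch j g →
      Integrable (((T K).op j g p).T ((T K).eterm (ρ₀ K t) j g)) (ν K (j + 1)))
    (hpres : ∀ K t j g, j < K → g ∈ (T K).adm j →
      ∫ x, (∑ p ∈ (T K).branch j g, ((T K).op j g p).T ((T K).eterm (ρ₀ K t) j g) x) ∂ν K (j + 1) =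
        ∫ x, (T K).eterm (ρ₀ K t) j g x ∂ν K j)
    (hintM : ∀ K t a, ∀ ι ∈ (skelFam T p₀ K).LIdx a,
      Integrable ((reprFam T p₀ ρ₀ hρ h0 B hB K t).eterm a ι) (ν K K))
    (K : ℕ) (t : ℝ) :
    ∑ τ ∈ HIndex.termSet (skelFam T p₀) K, Repr172R.weight (fun K => ν K K) (reprFam T p₀ ρ₀ hρ h0 B hB) t τ =
      ∫ U, ρ₀ K t U ∂ν K 0 := by
  rw [← Repr172R.integral_eq_sum_weight (fun K => ν K K) (reprFam T p₀ ρ₀ hρ h0 B hB) K t (densFam T ρ₀ K t)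
    (holdsFam T p₀ ρ₀ hρ h0 B hB hp₀ K t) (hintM K t)]
  exact (T K).integral_dens_eq_of_lt (ν K) (ρ₀ K t) K (hint K t) (hint' K t) (hpres K t)

end Family

/-! ## §8 Sanity (decided toy arithmetic; says NOTHING about Bałaban's objects): a history-blind two-step tower on the
one-point configuration spaces, two choices per step, `op j g p =` multiplication by `2` (`p = true`, the «small» choice)
or by `3`; `ρ₀ ≡ 1`, `B := 1`.  KERNEL-DECIDED: `ρ_1 = 5`, `ρ_2 = 25`; all-small term `4`, large summand `21`. -/

section Sanity

/-- toy: multiplication by a non-negative constant, as a map between one-point levels (all functions good). [folklore] -/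
def toyOp (c : ℝ) (hc : 0 ≤ c) : RelLinPosHom (GoodClass.top Unit) (GoodClass.top Unit) where
  T F x := c * F x
  map_good _ := trivial
  mono _ _ h x := mul_le_mul_of_nonneg_left (h x) hc
  add _ _ x := by
    show c * (_ + _) = _
    ring
  smul _ a x := by
    show c * (a * _) = a * (c * _)
    ring

/-- toy step maps: `true ↦ ×2`, `false ↦ ×3`, history-blind. [folklore] -/
def toyOps (p : Bool) : RelLinPosHom (GoodClass.top Unit) (GoodClass.top Unit) :=
  if p then toyOp 2 (by norm_num) else toyOp 3 (by norm_num)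

/-- toy tower: both choices admissible after every history. [folklore] -/
def toyT : Tower Bool (fun _ => Unit) (fun _ => GoodClass.top Unit) where
  branch _ _ := Finset.univ
  op _ _ p := toyOps p

/-- (S1a) one step: `ρ_1 = 2 + 3 = 5` by the history-blind recovery of (0.2). [folklore] -/
theorem toy_dens_one (V : Unit) : toyT.dens (fun _ => (1 : ℝ)) 1 V = 5 := by
  rw [toyT.dens_succ_eq_apply (ρ₀ := fun _ => (1 : ℝ)) trivial 0 Finset.univ toyOps (fun _ _ => rfl)
    (fun _ _ _ _ => rfl)]
  simp [toyOps, toyOp, Tower.dens_zero]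
  norm_num

/-- (S1b) two steps: `ρ_2 = (2 + 3)·5 = 25`. [folklore] -/
theorem toy_dens_two (V : Unit) : toyT.dens (fun _ => (1 : ℝ)) 2 V = 25 := by
  rw [toyT.dens_succ_eq_apply (ρ₀ := fun _ => (1 : ℝ)) trivial 1 Finset.univ toyOps (fun _ _ => rfl)
    (fun _ _ _ _ => rfl)]
  simp [toyOps, toyOp, toy_dens_one]
  norm_num

/-- (S2) the all-small history term (`true, true`) is `2·2·1 = 4`. [folklore] -/
theorem toy_eterm_small (V : Unit) : toyT.eterm (fun _ => (1 : ℝ)) 2 (hsmall (fun _ => true) 2) V = 4 := by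
  simp [Tower.eterm, hsmall, Fin.init, toyT, toyOps, toyOp]
  norm_num

/-- (S3) `holds` at the toy (`B := 1`): `25 = term true + term false` with `term false = 4`, hence `term true = 21` —
the skeleton and operations are inhabited NON-VACUOUSLY and the split is the advertised one. [folklore] -/
example : (reprOf toyT (fun _ => true) 2 (ρ₀ := fun _ => (1 : ℝ)) trivial (fun _ => zero_le_one)
    (one_pos : (0 : ℝ) < 1)).term true () = 21 := by
  have h := holds toyT (fun _ => true) 2 (ρ₀ := fun _ => (1 : ℝ)) trivial (fun _ => zero_le_one)
    (one_pos : (0 : ℝ) < 1) (fun _ _ => Finset.mem_univ _) ()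
  have h4 : (reprOf toyT (fun _ => true) 2 (ρ₀ := fun _ => (1 : ℝ)) trivial (fun _ => zero_le_one)
      (one_pos : (0 : ℝ) < 1)).term false () = 4 := by rw [term_false, toy_eterm_small]
  have hs := Fintype.sum_bool fun a =>
    (reprOf toyT (fun _ => true) 2 (ρ₀ := fun _ => (1 : ℝ)) trivial (fun _ => zero_le_one)
      (one_pos : (0 : ℝ) < 1)).term a ()
  rw [← h, toy_dens_two] at hs
  linarith

end Sanity

end Summit.QuantumFields.BalabanUV.T4Continuum.B16HistoryReprInstance
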